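import Summits.NavierStokesRegularity.NavierStokesRegularity.Theorems.RecurrentProfilesRecurrentReductionOrbit
import HarnessLib

/-!
# Crux `RecurrentLiouville` (stmt-NavierStokesRegularity-1589), line `Sketch` — stub S1b, part 1:
# the uniform shell bound (`stub_satApexShellBound`)

Theorems-only file (no definitions, no named facts).  For an origin-singular member `(u, p, G, C)`
of the crux's class (suitable weak on `ℝ³ × ℝ₋`, weak gradient, Albritton–Barker `𝐈 < ∞`, rate
`‖u(t,x)‖ ≤ C/√(−t)`) whose SCALING HULL IS SATELLITE-FREE (every `L³_loc`-limit of rescalings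
`u_{c_n}` that is again a singular class profile has no backward singular point `(0, x)`, `x ≠ 0`)
the rescalings are essentially bounded on the unit shell, uniformly along the orbit:
`∃ r ∈ (0,1], K : ∀ c > 0, ∀ ŷ, 1 ≤ ‖ŷ‖ ≤ 2 → ‖u_c‖_{L^∞(Q((0,ŷ), r))} ≤ K`.
Proof: otherwise blow-up scales `c_n` and shell points `ŷ_n → ŷ⋆` give
`‖u_{c_n}‖_{L^∞(Q((0,ŷ⋆),R))} → ∞` for every `R`; translating by `ŷ⋆` (a Navier–Stokes zoom with
factor `1`: class, rate and `𝐈` are kept) and running the tree's engine `slab_typeI_compactness`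
(Albritton–Barker 2019, Lemma 2.2 + Prop. 2.3, persistence of singularities) yields a limit
singular at ITS origin; translated back it is a hull member — a singular class profile — with the
satellite `(0, ŷ⋆)`.  Part 2 (`…ApexOfNoSatellites.lean`) turns the shell bound into the apex
bound by dyadic scaling and lands the registered stub `stub_satApexOfNoSatellites`.

## References

* D. Albritton, T. Barker, J. Math. Fluid Mech. 21 (2019), no. 43 = arXiv:1811.00502, Lemma 2.2,
  Prop. 2.3, §3. [AlbrittonBarker2019]
* G. Koch, N. Nadirashvili, G. Seregin, V. Šverák, Acta Math. 203 (2009), (1.4). [KNSS2009]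
-/

noncomputable section

-- the sub-problem namespace repeats the summit name (D-0017 layout `Summit.<S>.<P>.Theorems`)
set_option linter.dupNamespace false

namespace Summit.NavierStokesRegularity.NavierStokesRegularity.Theorems

open MeasureTheory Set Function Filter Topology TopologicalSpace Metric
open Literature.Analysis.FluidPDE
open scoped NNReal ENNReal

/-! ### Space translations as Navier–Stokes zooms with factor `1` -/

section Translate

variable {F : Type*}

/-- The space translation by `y` is the space–time affine map `Φ(s, x) = (s, y + x)`
(`stAffine 1 1 0 y`). [folklore] -/
theorem satAS_stAffine_one_apply (y : EuclideanSpace ℝ (Fin 3)) (z : ℝ × EuclideanSpace ℝ (Fin 3)) :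
    stAffine (1 : ℝ) 1 0 y z = (z.1, y + z.2) := by
  ext <;> simp

/-- Space translations preserve the open backward slab (`Opens` form). [folklore] -/
theorem satAS_stPreimage_one_slab (y : EuclideanSpace ℝ (Fin 3)) :
    stPreimage ((1 : ℝ) ^ 2) 1 0 y (slab (EuclideanSpace ℝ (Fin 3)) (Iio 0) isOpen_Iio) =
      slab (EuclideanSpace ℝ (Fin 3)) (Iio 0) isOpen_Iio := by
  apply Opens.ext
  ext z
  simp

/-- Space translations preserve the half space `ℝ³ × ℝ₋` (set form). [folklore] -/
theorem satAS_preimage_one_lowerHalf (y : EuclideanSpace ℝ (Fin 3)) :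
    stAffine ((1 : ℝ) ^ 2) 1 0 y ⁻¹' (Iio (0 : ℝ) ×ˢ (univ : Set (EuclideanSpace ℝ (Fin 3)))) =
      Iio (0 : ℝ) ×ˢ univ := by
  ext ⟨s, x⟩
  simp

/-- The translate of a backward parabolic ball: `Φ⁻¹ Q((t, y + x), r) = Q((t, x), r)` for the
space translation `Φ(s, x) = (s, y + x)`. [folklore] -/
theorem satAS_preimage_one_parabolicCylinder (y : EuclideanSpace ℝ (Fin 3)) (r : ℝ)
    (z : ℝ × EuclideanSpace ℝ (Fin 3)) :
    stAffine (1 : ℝ) 1 0 y ⁻¹' parabolicCylinder r (z.1, y + z.2) = parabolicCylinder r z := by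
  ext ⟨s, x⟩
  simp only [mem_preimage, satAS_stAffine_one_apply, mem_parabolicCylinder, dist_eq_norm,
    add_sub_add_left_eq_sub]

variable {u : ℝ → EuclideanSpace ℝ (Fin 3) → EuclideanSpace ℝ (Fin 3)}
  {p : ℝ → EuclideanSpace ℝ (Fin 3) → ℝ}
  {G : ℝ → EuclideanSpace ℝ (Fin 3) → EuclideanSpace ℝ (Fin 3) →L[ℝ] EuclideanSpace ℝ (Fin 3)}

/-- **Translates are slab profiles with the same `𝐈`.**  If `(u, p)` is a suitable weak solution
on `ℝ³ × ℝ₋` with weak gradient `G`, then so is its space translate `u(s, y + x)` (with the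
translated pressure and gradient), with the SAME Albritton–Barker quantity: covariance of suitable
weak solutions (the zoom with factor `1`) and translation invariance of `𝐈(ℝ³ × ℝ₋)`
(A–B §3, "by translating in space-time and rescaling"). [cite: AlbrittonBarker2019, §3] -/
theorem satAS_translate_slabProfile
    (hsw : IsSuitableWeakSolutionOn (slab (EuclideanSpace ℝ (Fin 3)) (Iio 0) isOpen_Iio) 1 0 u p)
    (hwg : HasWeakSpatialGradientOn (slab (EuclideanSpace ℝ (Fin 3)) (Iio 0) isOpen_Iio) u G)
    (y : EuclideanSpace ℝ (Fin 3)) :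
    IsSuitableWeakSolutionOn (slab (EuclideanSpace ℝ (Fin 3)) (Iio 0) isOpen_Iio) 1 0
        ((1 : ℝ) • stPull ((1 : ℝ) ^ 2) 1 0 y u) ((1 : ℝ) ^ 2 • stPull ((1 : ℝ) ^ 2) 1 0 y p) ∧
      HasWeakSpatialGradientOn (slab (EuclideanSpace ℝ (Fin 3)) (Iio 0) isOpen_Iio)
        ((1 : ℝ) • stPull ((1 : ℝ) ^ 2) 1 0 y u) ((1 : ℝ) ^ 2 • stPull ((1 : ℝ) ^ 2) 1 0 y G) ∧
      typeIBound (Iio (0 : ℝ) ×ˢ univ) ((1 : ℝ) • stPull ((1 : ℝ) ^ 2) 1 0 y u)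
          ((1 : ℝ) ^ 2 • stPull ((1 : ℝ) ^ 2) 1 0 y p) ((1 : ℝ) ^ 2 • stPull ((1 : ℝ) ^ 2) 1 0 y G) =
        typeIBound (Iio (0 : ℝ) ×ˢ univ) u p G := by
  refine ⟨?_, ?_, ?_⟩
  · have h := zoom_isSuitableWeakSolutionOn hsw one_pos 0 y
    rwa [satAS_stPreimage_one_slab] at h
  · have h := zoom_hasWeakSpatialGradientOn hwg one_pos 0 y
    rwa [satAS_stPreimage_one_slab] at h
  · conv_lhs => rw [← satAS_preimage_one_lowerHalf y]
    exact typeIBound_nsZoom one_pos 0 y _ u p G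

/-- Space translates keep the Type-I rate (the bound `C/√(−t)` does not see `x`). [cite: KNSS2009, (1.4)] -/
theorem satAS_translate_rate {C : ℝ} (hdec : HasTypeITimeDecay C u) (y : EuclideanSpace ℝ (Fin 3)) :
    HasTypeITimeDecay C ((1 : ℝ) • stPull ((1 : ℝ) ^ 2) 1 0 y u) := by
  intro t ht x
  rw [smul_stPull_apply, one_smul, one_pow, one_mul, zero_add]
  exact hdec t ht _

/-- **`L^∞` norms on backward balls are transported by space translations**:
`‖u(·, y + ·)‖_{L^∞(Q((t, x), r))} = ‖u‖_{L^∞(Q((t, y + x), r))}`. [folklore] -/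
theorem satAS_eLpNorm_top_translate (y : EuclideanSpace ℝ (Fin 3)) (r : ℝ)
    (z : ℝ × EuclideanSpace ℝ (Fin 3)) (f : ℝ → EuclideanSpace ℝ (Fin 3) → EuclideanSpace ℝ (Fin 3)) :
    eLpNorm (uncurry ((1 : ℝ) • stPull ((1 : ℝ) ^ 2) 1 0 y f)) ∞
        (volume.restrict (parabolicCylinder r z)) =
      eLpNorm (uncurry f) ∞ (volume.restrict (parabolicCylinder r (z.1, y + z.2))) := by
  have h := eLpNorm_top_nsZoom one_pos (0 : ℝ) y r z f
  rw [ENNReal.ofReal_one, one_mul, one_mul] at h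
  rw [h, one_pow, satAS_stAffine_one_apply]

/-- **`L³` norms on backward balls are transported by space translations**:
`‖f(·, y + ·)‖_{L³(Q((t, x), r))} = ‖f‖_{L³(Q((t, y + x), r))}`. [folklore] -/
theorem satAS_eLpNorm_three_translate [NormedAddCommGroup F] (y : EuclideanSpace ℝ (Fin 3)) (r : ℝ)
    (z : ℝ × EuclideanSpace ℝ (Fin 3)) (f : ℝ → EuclideanSpace ℝ (Fin 3) → F) :
    eLpNorm (uncurry (stPull (1 : ℝ) 1 0 y f)) 3 (volume.restrict (parabolicCylinder r z)) =
      eLpNorm (uncurry f) 3 (volume.restrict (parabolicCylinder r (z.1, y + z.2))) := by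
  have h := eLpNorm_comp_stAffine_preimage one_pos one_pos (0 : ℝ) y (uncurry f)
    (parabolicCylinder r (z.1, y + z.2)) (q := 3) (by norm_num) (by norm_num)
  rw [satAS_preimage_one_parabolicCylinder, one_pow, mul_one, inv_one, ENNReal.ofReal_one,
    ENNReal.one_rpow, one_mul] at h
  rw [← h]
  rfl

end Translate

/-! ### The uniform shell bound along the scaling orbit -/

/-- `Q((0, y), ρ) ⊆ Q((0, y'), R)` when `dist y y' + ρ ≤ R`. [folklore] -/
theorem satAS_parabolicCylinder_subset_of_dist {y y' : EuclideanSpace ℝ (Fin 3)} {ρ R : ℝ}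
    (hρ : 0 ≤ ρ) (h : dist y y' + ρ ≤ R) :
    parabolicCylinder ρ ((0 : ℝ), y) ⊆ parabolicCylinder R ((0 : ℝ), y') := by
  intro w hw
  rw [mem_parabolicCylinder] at hw ⊢
  have hρR : ρ ≤ R := by linarith [dist_nonneg (x := y) (y := y')]
  have h2 : ρ ^ 2 ≤ R ^ 2 := pow_le_pow_left₀ hρ hρR 2
  refine ⟨⟨by linarith [hw.1.1], hw.1.2⟩, ?_⟩
  calc dist w.2 y' ≤ dist w.2 y + dist y y' := dist_triangle _ _ _
    _ < ρ + dist y y' := by linarith [hw.2]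
    _ ≤ R := by linarith

/-- **S1b, part 1: the uniform shell bound** (registered tools stub of line `Sketch`).  For an
origin-singular class profile `(u, p, G, C)` with satellite-free scaling hull, the rescalings
`u_c` are essentially bounded by some `K` on `Q((0, ŷ), r)`, uniformly in `c > 0` and
`1 ≤ ‖ŷ‖ ≤ 2`.  By contradiction: blow-up scales and shell points `ŷ_n → ŷ⋆`, translation by `ŷ⋆`,
`slab_typeI_compactness` (A–B Lemma 2.2 + persistence of singularities, Prop. 2.3),
`exists_rate_profile_repr`, translation back (`exists_orbit_limit` + uniqueness of `L³_loc`
limits for the singular origin): a hull member with the satellite `(0, ŷ⋆)`.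
[cite: AlbrittonBarker2019, Lemma 2.2, Prop. 2.3 and §3] -/
theorem stub_satApexShellBound :
    ∀ (u : ℝ → EuclideanSpace ℝ (Fin 3) → EuclideanSpace ℝ (Fin 3))
      (p : ℝ → EuclideanSpace ℝ (Fin 3) → ℝ)
      (G : ℝ → EuclideanSpace ℝ (Fin 3) → EuclideanSpace ℝ (Fin 3) →L[ℝ] EuclideanSpace ℝ (Fin 3)) (C : ℝ),
      IsSuitableWeakSolutionOn (slab (EuclideanSpace ℝ (Fin 3)) (Iio 0) isOpen_Iio) 1 0 u p →
      HasWeakSpatialGradientOn (slab (EuclideanSpace ℝ (Fin 3)) (Iio 0) isOpen_Iio) u G →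
      typeIBound (Iio (0 : ℝ) ×ˢ univ) u p G < ⊤ → HasTypeITimeDecay C u →
      IsBackwardSingularPoint u 0 →
      (∀ (c : ℕ → ℝ) (v : ℝ → EuclideanSpace ℝ (Fin 3) → EuclideanSpace ℝ (Fin 3))
        (q : ℝ → EuclideanSpace ℝ (Fin 3) → ℝ)
        (H : ℝ → EuclideanSpace ℝ (Fin 3) → EuclideanSpace ℝ (Fin 3) →L[ℝ] EuclideanSpace ℝ (Fin 3)),
        (∀ n, 0 < c n) →
        IsSuitableWeakSolutionOn (slab (EuclideanSpace ℝ (Fin 3)) (Iio 0) isOpen_Iio) 1 0 v q →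
        HasWeakSpatialGradientOn (slab (EuclideanSpace ℝ (Fin 3)) (Iio 0) isOpen_Iio) v H →
        typeIBound (Iio (0 : ℝ) ×ˢ univ) v q H < ⊤ → HasTypeITimeDecay C v →
        IsBackwardSingularPoint v 0 →
        (∀ R : ℝ, 0 < R → Tendsto (fun n => eLpNorm (uncurry (nsRescale (c n) u) - uncurry v) 3
          (volume.restrict (parabolicCylinder R (0 : ℝ × EuclideanSpace ℝ (Fin 3))))) atTop (𝓝 0)) →
        ∀ x : EuclideanSpace ℝ (Fin 3), x ≠ 0 → ¬ IsBackwardSingularPoint v (0, x)) →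
      ∃ r : ℝ, 0 < r ∧ r ≤ 1 ∧ ∃ K : ℝ≥0, ∀ c : ℝ, 0 < c →
        ∀ y : EuclideanSpace ℝ (Fin 3), 1 ≤ ‖y‖ → ‖y‖ ≤ 2 →
          eLpNorm (uncurry (nsRescale c u)) ∞
            (volume.restrict (parabolicCylinder r ((0 : ℝ), y))) ≤ K := by
  intro u p G C hsw hwg hI hdec hsing hhull
  by_contra hneg
  push Not at hneg
  -- `0 ≤ C`, from the rate at `(t, x) = (-1, 0)`
  have hC0 : 0 ≤ C := by
    have h := hdec (-1) (by norm_num) 0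
    have h1 : (0 : ℝ) ≤ C / Real.sqrt (-(-1 : ℝ)) := (norm_nonneg _).trans h
    rw [neg_neg, Real.sqrt_one, div_one] at h1
    exact h1
  -- ## Step 1: blow-up scales `c n` and shell points `y n`
  have hseq : ∀ n : ℕ, ∃ c : ℝ, 0 < c ∧ ∃ y : EuclideanSpace ℝ (Fin 3), 1 ≤ ‖y‖ ∧ ‖y‖ ≤ 2 ∧
      ((n : ℝ≥0) : ℝ≥0∞) < eLpNorm (uncurry (nsRescale c u)) ∞
        (volume.restrict (parabolicCylinder (1 / ((n : ℝ) + 1)) ((0 : ℝ), y))) := by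
    intro n
    have h1 : (0 : ℝ) < 1 / ((n : ℝ) + 1) := by positivity
    have h2 : 1 / ((n : ℝ) + 1) ≤ 1 := by
      rw [div_le_one (by positivity)]
      linarith [n.cast_nonneg (α := ℝ)]
    exact hneg _ h1 h2 n
  choose c hc y hy1 hy2 hbig using hseq
  -- ## Step 2: a convergent subsequence of shell points
  set S : Set (EuclideanSpace ℝ (Fin 3)) := closedBall 0 2 ∩ (ball 0 1)ᶜ with hSdef
  have hS : IsCompact S := (isCompact_closedBall _ _).inter_right isOpen_ball.isClosed_compl
  have hyS : ∀ n, y n ∈ S := fun n =>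
    ⟨mem_closedBall_zero_iff.2 (hy2 n), fun h => by
      have h' := mem_ball_zero_iff.1 h
      linarith [hy1 n]⟩
  obtain ⟨ys, hysS, φ, hφ, hφlim⟩ := hS.tendsto_subseq hyS
  have hys1 : 1 ≤ ‖ys‖ := by
    have h := hysS.2
    rw [mem_compl_iff, mem_ball_zero_iff, not_lt] at h
    exact h
  have hys0 : ys ≠ 0 := fun h => by
    rw [h, norm_zero] at hys1
    linarith
  -- ## Step 3: blow-up at the fixed centre `ys`
  have hblow : ∀ R : ℝ, 0 < R → Tendsto (fun n => eLpNorm (uncurry (nsRescale (c (φ n)) u)) ∞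
      (volume.restrict (parabolicCylinder R ((0 : ℝ), ys)))) atTop (𝓝 ∞) := by
    intro R hR
    have h1 : ∀ᶠ n in atTop, dist (y (φ n)) ys < R / 2 :=
      Metric.tendsto_nhds.1 hφlim (R / 2) (by positivity)
    obtain ⟨N, hN⟩ := exists_nat_ge (2 / R)
    have h2 : ∀ᶠ n : ℕ in atTop, 1 / (((φ n : ℕ) : ℝ) + 1) ≤ R / 2 := by
      filter_upwards [eventually_ge_atTop N] with n hn
      have hφn : (N : ℝ) ≤ (φ n : ℕ) := by exact_mod_cast hn.trans (hφ.id_le n)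
      rw [div_le_iff₀ (by positivity)]
      have hR2 : 2 ≤ R * N := by
        have := (div_le_iff₀ hR).1 hN
        linarith
      nlinarith
    refine tendsto_nhds_top_mono (ENNReal.tendsto_nat_nhds_top) ?_
    filter_upwards [h1, h2] with n hn1 hn2
    have hsub : parabolicCylinder (1 / (((φ n : ℕ) : ℝ) + 1)) ((0 : ℝ), y (φ n)) ⊆
        parabolicCylinder R ((0 : ℝ), ys) :=
      satAS_parabolicCylinder_subset_of_dist (by positivity) (by linarith [hn1.le])
    calc ((n : ℕ) : ℝ≥0∞) ≤ ((φ n : ℕ) : ℝ≥0∞) := by exact_mod_cast hφ.id_le n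
      _ = (((φ n : ℕ) : ℝ≥0) : ℝ≥0∞) := (ENNReal.coe_natCast _).symm
      _ ≤ eLpNorm (uncurry (nsRescale (c (φ n)) u)) ∞
          (volume.restrict (parabolicCylinder (1 / (((φ n : ℕ) : ℝ) + 1)) ((0 : ℝ), y (φ n)))) :=
        (hbig (φ n)).le
      _ ≤ eLpNorm (uncurry (nsRescale (c (φ n)) u)) ∞
          (volume.restrict (parabolicCylinder R ((0 : ℝ), ys))) :=
        eLpNorm_mono_measure _ (Measure.restrict_mono hsub le_rfl)
  -- ## Step 4: the orbit sequence and its translates by `ys` are class profiles with the same `𝐈`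
  set ps : ℕ → ℝ → EuclideanSpace ℝ (Fin 3) → ℝ :=
    fun n => (c (φ n)) ^ 2 • stPull ((c (φ n)) ^ 2) (c (φ n)) (0 : ℝ) (0 : EuclideanSpace ℝ (Fin 3)) p
    with hps
  set Gs : ℕ → ℝ → EuclideanSpace ℝ (Fin 3) → EuclideanSpace ℝ (Fin 3) →L[ℝ] EuclideanSpace ℝ (Fin 3) :=
    fun n => (c (φ n)) ^ 2 • stPull ((c (φ n)) ^ 2) (c (φ n)) (0 : ℝ) (0 : EuclideanSpace ℝ (Fin 3)) G
    with hGs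
  have hcls : ∀ n,
      IsSuitableWeakSolutionOn (slab (EuclideanSpace ℝ (Fin 3)) (Iio 0) isOpen_Iio) 1 0
        (nsRescale (c (φ n)) u) (ps n) ∧
      HasWeakSpatialGradientOn (slab (EuclideanSpace ℝ (Fin 3)) (Iio 0) isOpen_Iio)
        (nsRescale (c (φ n)) u) (Gs n) ∧
      typeIBound (Iio (0 : ℝ) ×ˢ univ) (nsRescale (c (φ n)) u) (ps n) (Gs n) =
        typeIBound (Iio (0 : ℝ) ×ˢ univ) u p G := by
    intro n
    rw [nsRescale_eq_zoom]
    exact zoom_slabProfile hsw hwg (hc (φ n))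
  set V : ℕ → ℝ → EuclideanSpace ℝ (Fin 3) → EuclideanSpace ℝ (Fin 3) :=
    fun n => (1 : ℝ) • stPull ((1 : ℝ) ^ 2) 1 0 ys (nsRescale (c (φ n)) u) with hV
  set qV : ℕ → ℝ → EuclideanSpace ℝ (Fin 3) → ℝ :=
    fun n => (1 : ℝ) ^ 2 • stPull ((1 : ℝ) ^ 2) 1 0 ys (ps n) with hqV
  set GV : ℕ → ℝ → EuclideanSpace ℝ (Fin 3) → EuclideanSpace ℝ (Fin 3) →L[ℝ] EuclideanSpace ℝ (Fin 3) :=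
    fun n => (1 : ℝ) ^ 2 • stPull ((1 : ℝ) ^ 2) 1 0 ys (Gs n) with hGV
  have hVcls : ∀ n,
      IsSuitableWeakSolutionOn (slab (EuclideanSpace ℝ (Fin 3)) (Iio 0) isOpen_Iio) 1 0 (V n) (qV n) ∧
      HasWeakSpatialGradientOn (slab (EuclideanSpace ℝ (Fin 3)) (Iio 0) isOpen_Iio) (V n) (GV n) ∧
      typeIBound (Iio (0 : ℝ) ×ˢ univ) (V n) (qV n) (GV n) = typeIBound (Iio (0 : ℝ) ×ˢ univ) u p G := by
    intro n
    obtain ⟨h1, h2, h3⟩ := hcls n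
    obtain ⟨k1, k2, k3⟩ := satAS_translate_slabProfile h1 h2 ys
    exact ⟨k1, k2, k3.trans h3⟩
  have hVrate : ∀ n, HasTypeITimeDecay C (V n) := fun n =>
    satAS_translate_rate (hdec.nsRescale (hc (φ n))) ys
  -- ## Step 5: the engine (A–B Lemma 2.2 + Prop. 2.3) on the translated sequence
  obtain ⟨w, pw, Hw, σ, hσ, hsww, hwgw, hIw, hconv, hpers⟩ :=
    slab_typeI_compactness (typeIBound (Iio (0 : ℝ) ×ˢ univ) u p G) V qV GV hI
      (fun n => (hVcls n).1) (fun n => (hVcls n).2.1) (fun n => (hVcls n).2.2.le)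
  -- persistence fires: the translated frame blows up at its origin
  have hsingw : IsBackwardSingularPoint w 0 := by
    refine hpers fun R hR => ?_
    have e : ∀ j, eLpNorm (uncurry (V (σ j))) ∞
        (volume.restrict (parabolicCylinder R (0 : ℝ × EuclideanSpace ℝ (Fin 3)))) =
        eLpNorm (uncurry (nsRescale (c (φ (σ j))) u)) ∞
          (volume.restrict (parabolicCylinder R ((0 : ℝ), ys))) := by
      intro j
      rw [hV, satAS_eLpNorm_top_translate]
      simp
    have ht : Tendsto (fun j => eLpNorm (uncurry (V (σ j))) ∞
        (volume.restrict (parabolicCylinder R (0 : ℝ × EuclideanSpace ℝ (Fin 3))))) atTop (𝓝 ∞) := by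
      simp_rw [e]
      exact (hblow R hR).comp hσ.tendsto_atTop
    exact ht.limsup_eq
  -- ## Step 6: the rate for the limit, and a pointwise-rate representative
  have hIw' : typeIBound (Iio (0 : ℝ) ×ˢ univ) w pw Hw < ⊤ :=
    lt_of_le_of_lt hIw (ENNReal.mul_lt_top (by simp) hI)
  have hVm : ∀ (m : ℕ) (j : ℕ), AEStronglyMeasurable (uncurry (V (σ j)))
      (volume.restrict (parabolicCylinder ((m : ℝ) + 1) (0 : ℝ × EuclideanSpace ℝ (Fin 3)))) :=
    fun m j => (hVcls (σ j)).2.1.locallyIntegrableOn.aestronglyMeasurable.mono_measure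
      (Measure.restrict_mono (parabolicCylinder_origin_subset_slab _) le_rfl)
  have hwm : ∀ m : ℕ, AEStronglyMeasurable (uncurry w)
      (volume.restrict (parabolicCylinder ((m : ℝ) + 1) (0 : ℝ × EuclideanSpace ℝ (Fin 3)))) :=
    fun m => hwgw.locallyIntegrableOn.aestronglyMeasurable.mono_measure
      (Measure.restrict_mono (parabolicCylinder_origin_subset_slab _) le_rfl)
  have hrate : ∀ᵐ z ∂(volume.restrict (Iio (0 : ℝ) ×ˢ (univ : Set (EuclideanSpace ℝ (Fin 3))))),
      ‖w z.1 z.2‖ ≤ C / Real.sqrt (-z.1) :=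
    ae_rate_of_tendsto_eLpNorm (v := fun j => V (σ j)) (fun j => hVrate (σ j)) hVm hwm
      (fun m => hconv _ (by positivity))
  obtain ⟨w', hae, hsww', hwgw', hIw'', hdecw', hsingw'⟩ :=
    exists_rate_profile_repr hC0 hsww hwgw hIw' hsingw hrate
  -- ## Step 7: translate back — the hull member `v` with the satellite `(0, ys)`
  set v : ℝ → EuclideanSpace ℝ (Fin 3) → EuclideanSpace ℝ (Fin 3) :=
    (1 : ℝ) • stPull ((1 : ℝ) ^ 2) 1 0 (-ys) w' with hv
  obtain ⟨hswv, hwgv, hIv⟩ := satAS_translate_slabProfile hsww' hwgw' (-ys)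
  rw [← hv] at hswv hwgv hIv
  have hIv' : typeIBound (Iio (0 : ℝ) ×ˢ univ) v ((1 : ℝ) ^ 2 • stPull ((1 : ℝ) ^ 2) 1 0 (-ys) pw)
      ((1 : ℝ) ^ 2 • stPull ((1 : ℝ) ^ 2) 1 0 (-ys) Hw) < ⊤ := hIv ▸ hIw''
  have hdecv : HasTypeITimeDecay C v := satAS_translate_rate hdecw' (-ys)
  have hsat : IsBackwardSingularPoint v (0, ys) := by
    intro r hr
    rw [hv, satAS_eLpNorm_top_translate]
    simp only [neg_add_cancel]
    exact hsingw' r hr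
  -- the orbit subsequence converges to `v`
  have hconvv : ∀ R : ℝ, 0 < R → Tendsto (fun j => eLpNorm (uncurry (nsRescale (c (φ (σ j))) u) - uncurry v) 3
      (volume.restrict (parabolicCylinder R (0 : ℝ × EuclideanSpace ℝ (Fin 3))))) atTop (𝓝 0) := by
    intro R hR
    set R' : ℝ := R + ‖ys‖ with hR'
    have hR'0 : 0 < R' := by positivity
    have h1 : Tendsto (fun j => eLpNorm (uncurry (V (σ j)) - uncurry w') 3
        (volume.restrict (parabolicCylinder R' (0 : ℝ × EuclideanSpace ℝ (Fin 3))))) atTop (𝓝 0) := by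
      refine (hconv R' hR'0).congr fun j => eLpNorm_congr_ae ?_
      have haeR := ae_restrict_of_ae_restrict_of_subset (parabolicCylinder_origin_subset_slab R') hae
      filter_upwards [haeR] with z hz
      rw [Pi.sub_apply, Pi.sub_apply, hz]
    have h2 : ∀ j, eLpNorm (uncurry (V (σ j)) - uncurry w') 3
        (volume.restrict (parabolicCylinder R' (0 : ℝ × EuclideanSpace ℝ (Fin 3)))) =
        eLpNorm (uncurry (nsRescale (c (φ (σ j))) u) - uncurry v) 3
          (volume.restrict (parabolicCylinder R' ((0 : ℝ), ys))) := by
      intro j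
      have e : uncurry (V (σ j)) - uncurry w' =
          uncurry (stPull (1 : ℝ) 1 0 ys (nsRescale (c (φ (σ j))) u - v)) := by
        funext z
        obtain ⟨s, x⟩ := z
        simp only [hV, hv, Pi.sub_apply, uncurry_apply_pair, stPull_apply, one_smul, one_pow,
          one_mul, zero_add, neg_add_cancel_left]
      have e' : uncurry (nsRescale (c (φ (σ j))) u) - uncurry v =
          uncurry (nsRescale (c (φ (σ j))) u - v) := by
        funext z
        rfl
      rw [e, e', satAS_eLpNorm_three_translate]
      simp
    have hsub : parabolicCylinder R (0 : ℝ × EuclideanSpace ℝ (Fin 3)) ⊆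
        parabolicCylinder R' ((0 : ℝ), ys) := by
      have h := satAS_parabolicCylinder_subset_of_dist (y := (0 : EuclideanSpace ℝ (Fin 3)))
        (y' := ys) hR.le (R := R') (by rw [hR', dist_zero_left]; linarith)
      exact h
    have h3 : Tendsto (fun j => eLpNorm (uncurry (nsRescale (c (φ (σ j))) u) - uncurry v) 3
        (volume.restrict (parabolicCylinder R' ((0 : ℝ), ys)))) atTop (𝓝 0) := by
      simpa only [h2] using h1
    exact tendsto_of_tendsto_of_tendsto_of_le_of_le tendsto_const_nhds h3 (fun _ => zero_le)
      (fun j => eLpNorm_mono_measure _ (Measure.restrict_mono hsub le_rfl))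
  -- ## Step 8: `v` is singular at the origin (orbit limit + uniqueness of `L³_loc` limits)
  obtain ⟨u'', p'', H'', ψ, hψ, -, hwg'', -, hsing'', -, hconv''⟩ :=
    exists_orbit_limit hsw hwg hI hsing hdec (fun j => c (φ (σ j))) (fun j => hc _)
  have hvm' : ∀ m : ℕ, AEStronglyMeasurable (uncurry v)
      (volume.restrict (parabolicCylinder ((m : ℝ) + 1) (0 : ℝ × EuclideanSpace ℝ (Fin 3)))) :=
    fun m => hwgv.locallyIntegrableOn.aestronglyMeasurable.mono_measure
      (Measure.restrict_mono (parabolicCylinder_origin_subset_slab _) le_rfl)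
  have hum'' : ∀ m : ℕ, AEStronglyMeasurable (uncurry u'')
      (volume.restrict (parabolicCylinder ((m : ℝ) + 1) (0 : ℝ × EuclideanSpace ℝ (Fin 3)))) :=
    fun m => hwg''.locallyIntegrableOn.aestronglyMeasurable.mono_measure
      (Measure.restrict_mono (parabolicCylinder_origin_subset_slab _) le_rfl)
  have hseqm : ∀ (m : ℕ) (j : ℕ), AEStronglyMeasurable (uncurry (nsRescale (c (φ (σ (ψ j)))) u))
      (volume.restrict (parabolicCylinder ((m : ℝ) + 1) (0 : ℝ × EuclideanSpace ℝ (Fin 3)))) :=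
    fun m j => (hcls (σ (ψ j))).2.1.locallyIntegrableOn.aestronglyMeasurable.mono_measure
      (Measure.restrict_mono (parabolicCylinder_origin_subset_slab _) le_rfl)
  have hae2 : ∀ᵐ z ∂(volume.restrict (Iio (0 : ℝ) ×ˢ (univ : Set (EuclideanSpace ℝ (Fin 3))))),
      uncurry u'' z = uncurry v z :=
    ae_eq_lowerHalf_of_tendsto_eLpNorm (v := fun j => nsRescale (c (φ (σ (ψ j)))) u) hseqm hum'' hvm'
      (fun m => hconv'' _ (by positivity))
      (fun m => (hconvv _ (by positivity)).comp hψ.tendsto_atTop)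
  have hsingv : IsBackwardSingularPoint v 0 :=
    hsing''.congr_ae (fun r _ => parabolicCylinder_origin_subset_slab r) hae2
  -- ## Step 9: contradiction with the satellite-free hull
  exact hhull (fun j => c (φ (σ j))) v _ _ (fun j => hc _) hswv hwgv hIv' hdecv hsingv hconvv ys hys0 hsat

end Summit.NavierStokesRegularity.NavierStokesRegularity.Theorems

end
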